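import Summits.QuantumAdvantage.QuantumAdvantage.Theses.OddPrimeWalk
import Summits.QuantumAdvantage.AdviceFreeQNC0.WalkHardFGap
import HarnessLib

/-!
# Route OddPrimeWalk, item `GapOdd` (stmt-QuantumAdvantage-22731): rung R3 for every prime `p ≥ 5`

The route's aside `GapOdd` — `∀ p ≥ 5 prime, WalkHardFGap p` (a polylog-degree `𝔽_p` strategy with `s` potentially-active cuts
and a cut-free bit interval of length `L ≥ s²(log₂ n)^{2C+2}` wins α's u-walk game on at most `θ·2ⁿ` inputs) — is the tree theorem
`Summit.QuantumAdvantage.AdviceFreeQNC0.walkHardFGap (p) (hp3 : p ≠ 3)` (`AdviceFreeQNC0/WalkHardFGap.lean`, the fibre argument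
over qn-prover g10's `elimLevelSqrtF`) at `p ≥ 5`.  WHAT THIS IS NOT: the dense residual `DenseResidualOdd` is open.
-/

set_option linter.dupNamespace false

namespace Summit.QuantumAdvantage.QuantumAdvantage.Theorems

/-- **Item `GapOdd` — PROVED**: `∀ p ≥ 5 prime, WalkHardFGap p` (one line over `AdviceFreeQNC0.walkHardFGap`). -/
theorem oddPrimeWalk_gapOdd : Summit.QuantumAdvantage.QuantumAdvantage.Theses.OddPrimeWalk.GapOdd :=
  fun p _ hp => Summit.QuantumAdvantage.AdviceFreeQNC0.walkHardFGap p (by omega)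

end Summit.QuantumAdvantage.QuantumAdvantage.Theorems
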